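import Mathlib.Analysis.SpecialFunctions.Gaussian.FourierTransform
import Mathlib.MeasureTheory.Constructions.Pi
import Mathlib.MeasureTheory.Integral.Prod
import Mathlib.MeasureTheory.Integral.Pi
import HarnessLib

/-!
# Integrating out one coordinate of a Gaussian weight (Fröhlich–Spencer 1982, Lemma 3)

Support file for the Coulomb-gas / sine-Gordon analysis of abelian lattice models at weak
coupling — the proof programme of the named fact
`Literature.MathematicalPhysics.QuantumFieldTheory.FrohlichSpencerU1PerimeterLawD4` (the `U(1)₄`
perimeter law, Fröhlich–Spencer 1982 §2) and of its corollary
`Literature.Barriers.QuantumFields.AbelianDeconfinementD4`. Everything is PROVED; no named fact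
is introduced (D-0026).

The renormalisation transformation of FS82 §2.8 rests on "the following simple identity"
(**Lemma 3**, p. 428): *Let `xy ⊂ Λ*`, and let `G(α)` be a function which does not depend on
`α_{xy}`. Then `∫ e^{iρ_{xy} α_{xy}} G(α) dμ⁰_Λ(α) = e^{-(β/2n_{xy}) ρ²_{xy}} ∫ e^{iρ_{xy} ᾱ_{xy}} G(α) dμ⁰_Λ(α)`,
where `ᾱ_{xy}` is independent of `α_{xy}` and `n_{xy} = card{p* ⊂ Λ* : xy ∈ ∂p*}` (`= 6` in
dimension `4`)* — proved (p. 429, (2.65)–(2.67)) by "explicitly integrating over `α_{xy}`": the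
Gaussian measure `dμ⁰_Λ ∝ e^{-(1/2β)(dα, dα)} ∏ dα` is, in the single variable `α_{xy}`, the
Gaussian `e^{-(n_{xy}/2β)(α_{xy} - ᾱ_{xy})²}` with `ᾱ_{xy}` the conditional mean, and the Fourier
transform of a Gaussian is a Gaussian.

We prove this for an ARBITRARY centred Gaussian weight `w_A(x) = exp(-½ ∑ᵢⱼ Aᵢⱼ xᵢ xⱼ)` on
`ℝ^ι` (`ι` finite, `A` symmetric with `A_{ee} > 0`, `w_A` integrable), a coordinate `e`, and a
bounded measurable `G` not depending on `x_e`: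

* `quadForm A x = ∑ᵢ ∑ⱼ Aᵢⱼ xᵢ xⱼ`, `offDiag A e x = ∑_{j ≠ e} A_{ej} x_j`,
  `condMean A e x = -(offDiag A e x)/A_{ee}` (the conditional mean `ᾱ_e`, independent of `x_e`),
  and `quadForm_update` (completing the square in the variable `x_e`:
  `Q(x|_{x_e = t}) = A_{ee} t² + 2t·offDiag + Q(x|_{x_e = 0})`);
* `integral_eq_integral_integral_ins` (Fubini: integrate the coordinate `e` first);
* `integral_gaussian_cexp_linear_oneDim` (the one-dimensional computation);
* `integral_gaussian_coord_cexp` (**FS82 Lemma 3**):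
  `∫ w_A(x) e^{iρ x_e} G(x) dx = e^{-ρ²/(2A_{ee})} ∫ w_A(x) e^{iρ ᾱ_e(x)} G(x) dx`;
* `lin c x = ⟨c, x⟩`, `renorm A b c`, `renormSet A B c` (FS82 (2.68): the renormalised density
  `ρ̄`), `integral_gaussian_lin_cexp` (Lemma 3 for a linear phase) and
  `integral_gaussian_lin_cexp_renormSet` (**iterated Lemma 3**, the core of Corollary 4): for
  mutually non-interacting coordinates `B` (`A_{bb'} = 0`),
  `∫ w_A e^{i⟨c,x⟩} G = e^{-∑_{b∈B} c_b²/(2A_{bb})} ∫ w_A e^{i⟨renormSet A B c, x⟩} G`;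
* `cosCoef`, `signs`, `prod_one_add_mul_cos_eq_sum` (the signed expansion
  `∏_k (1 + K_k cos u_k) = ∑_{σ ∈ {0,±1}^κ} (∏ a_{K_k}(σ_k)) e^{i∑σ_k u_k}`),
  `integral_prod_cos_expand`, `renormSet_biUnion_sum`, and
  `integral_gaussian_prod_cos_renorm` (**FS82 Corollary 4**):
  `∫ w_A ∏_k [1 + K_k cos(⟨ρ_k,x⟩ - θ_k)] G = ∫ w_A ∏_k [1 + z_k cos(⟨ρ̄_k,x⟩ - θ_k)] G` with
  `z_k = K_k e^{-∑_{b∈B_k} ρ_k(b)²/(2A_{bb})}` ((2.69)) and `ρ̄_k = renormSet A B_k ρ_k` ((2.68)).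

For FS82's dual Gaussian `A = (1/β)(δd + ε)` one has `A_{ee} = (n_e + ε)/β`, whence the factor
`e^{-βρ²/(2(n_e+ε))} ≤ e^{-(β/2(6+ε)) ρ²}` of (2.63)–(2.64); the normalisation of the Gaussian is
irrelevant (the identity is homogeneous in the weight).

## References

* J. Fröhlich, T. Spencer, *Massless phases and symmetry restoration in abelian gauge theories
  and spin systems*, Comm. Math. Phys. 83 (1982) 411–454, §2.8 Lemma 3, (2.63)–(2.67), pp. 428–429.
  [FrohlichSpencerCMP1982]
-/

noncomputable section

open MeasureTheory Complex Finset Function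
open scoped BigOperators Real

namespace Literature.Probability.LatticeModels

namespace GaussianCoord

variable {ι : Type*} [Fintype ι] [DecidableEq ι]

/-! ### The quadratic form and the conditional mean -/

/-- The quadratic form `Q_A(x) = ∑ᵢ ∑ⱼ Aᵢⱼ xᵢ xⱼ`. [folklore] -/
def quadForm (A : ι → ι → ℝ) (x : ι → ℝ) : ℝ := ∑ i, ∑ j, A i j * x i * x j

/-- The off-diagonal linear form `∑_{j ≠ e} A_{ej} x_j` of the coordinate `e`. [folklore] -/
def offDiag (A : ι → ι → ℝ) (e : ι) (x : ι → ℝ) : ℝ := ∑ j ∈ univ.erase e, A e j * x j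

/-- The conditional mean `ᾱ_e(x) = -(∑_{j≠e} A_{ej} x_j)/A_{ee}` of the coordinate `e` under the
Gaussian weight `e^{-Q_A/2}` (FS82's `ᾱ_{xy}`, "independent of `α_{xy}`").
[cite: FrohlichSpencerCMP1982, Lemma 3 p. 428] -/
def condMean (A : ι → ι → ℝ) (e : ι) (x : ι → ℝ) : ℝ := -offDiag A e x / A e e

/-- `offDiag` does not see the coordinate `e`. [folklore] -/
theorem offDiag_update (A : ι → ι → ℝ) (e : ι) (x : ι → ℝ) (t : ℝ) :
    offDiag A e (update x e t) = offDiag A e x :=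
  Finset.sum_congr rfl fun j hj => by rw [update_of_ne (Finset.ne_of_mem_erase hj)]

/-- `condMean` does not see the coordinate `e`. [folklore] -/
theorem condMean_update (A : ι → ι → ℝ) (e : ι) (x : ι → ℝ) (t : ℝ) :
    condMean A e (update x e t) = condMean A e x := by
  rw [condMean, condMean, offDiag_update]

/-- A sum against the indicator of `e`. [folklore] -/
theorem sum_mul_ite_eq (f : ι → ℝ) (e : ι) : ∑ j, f j * (if j = e then (1 : ℝ) else 0) = f e := by
  simp [Finset.sum_ite_eq']

/-- **Completing the square in one variable**: for symmetric `A`,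
`Q_A(x|_{x_e=t}) = A_{ee} t² + 2 t ∑_{j≠e} A_{ej} x_j + Q_A(x|_{x_e=0})`. [cite: FrohlichSpencerCMP1982, (2.65)–(2.66)] -/
theorem quadForm_update (A : ι → ι → ℝ) (hA : ∀ i j, A i j = A j i) (e : ι) (x : ι → ℝ) (t : ℝ) :
    quadForm A (update x e t) = A e e * t ^ 2 + 2 * t * offDiag A e x + quadForm A (update x e 0) := by
  -- write `update x e t = x₀ + t • δ_e` with `x₀ = update x e 0`
  set x₀ := update x e 0 with hx₀
  have hu : ∀ j, update x e t j = x₀ j + t * (if j = e then 1 else 0) := by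
    intro j
    by_cases hj : j = e
    · subst hj; simp [hx₀]
    · simp [hx₀, hj]
  have hoff : offDiag A e x = ∑ j, A e j * x₀ j := by
    rw [offDiag, ← Finset.add_sum_erase _ _ (Finset.mem_univ e)]
    simp only [hx₀, update_self, mul_zero, zero_add]
    exact Finset.sum_congr rfl fun j hj => by rw [update_of_ne (Finset.ne_of_mem_erase hj)]
  have hoff' : ∑ i, A i e * x₀ i = offDiag A e x := by
    rw [hoff]; exact Finset.sum_congr rfl fun i _ => by rw [hA i e]
  unfold quadForm
  simp_rw [hu]
  have hsplit : ∀ i j, A i j * (x₀ i + t * if i = e then 1 else 0) * (x₀ j + t * if j = e then 1 else 0) =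
      A i j * x₀ i * x₀ j + t * (A i j * x₀ i * (if j = e then 1 else 0)) +
        t * (A i j * x₀ j * (if i = e then 1 else 0)) +
        t ^ 2 * (A i j * (if i = e then 1 else 0) * (if j = e then 1 else 0)) := by
    intro i j; ring
  simp_rw [hsplit, Finset.sum_add_distrib, ← Finset.mul_sum]
  -- evaluate the indicator sums
  have h1 : ∑ i, ∑ j, A i j * x₀ i * (if j = e then (1 : ℝ) else 0) = offDiag A e x := by
    rw [← hoff']
    exact Finset.sum_congr rfl fun i _ => by rw [sum_mul_ite_eq (fun j => A i j * x₀ i) e]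
  have h2 : ∑ i, ∑ j, A i j * x₀ j * (if i = e then (1 : ℝ) else 0) = offDiag A e x := by
    rw [Finset.sum_comm, hoff]
    exact Finset.sum_congr rfl fun j _ => by rw [sum_mul_ite_eq (fun i => A i j * x₀ j) e]
  have h3 : ∑ i, ∑ j, A i j * (if i = e then (1 : ℝ) else 0) * (if j = e then 1 else 0) = A e e := by
    have : ∀ i, ∑ j, A i j * (if i = e then (1 : ℝ) else 0) * (if j = e then 1 else 0) =
        A i e * (if i = e then 1 else 0) := fun i => by
      rw [sum_mul_ite_eq (fun j => A i j * (if i = e then (1 : ℝ) else 0)) e]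
    simp_rw [this]
    rw [sum_mul_ite_eq (fun i => A i e) e]
  rw [h1, h2, h3]
  ring

/-! ### Inserting a value at the coordinate `e` -/

/-- The configuration with values `z` off `e` and value `t` at `e`. [folklore] -/
def ins (e : ι) (z : {i // i ≠ e} → ℝ) (t : ℝ) : ι → ℝ :=
  fun i => if h : i ≠ e then z ⟨i, h⟩ else t

omit [Fintype ι] in
/-- The value at `e`. [folklore] -/
@[simp] theorem ins_self (e : ι) (z : {i // i ≠ e} → ℝ) (t : ℝ) : ins e z t e = t := by
  simp [ins]

omit [Fintype ι] in
/-- Changing the inserted value is an update. [folklore] -/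
theorem ins_eq_update (e : ι) (z : {i // i ≠ e} → ℝ) (t s : ℝ) :
    ins e z t = update (ins e z s) e t := by
  funext i
  by_cases hi : i = e
  · subst hi; simp [ins]
  · rw [update_of_ne hi]; simp [ins, hi]

omit [Fintype ι] in
/-- Measurability of `ins` in the inserted value. [folklore] -/
theorem measurable_ins (e : ι) (z : {i // i ≠ e} → ℝ) : Measurable (ins e z) := by
  refine measurable_pi_iff.2 fun i => ?_
  by_cases hi : i ≠ e
  · have : (fun t : ℝ => ins e z t i) = fun _ => z ⟨i, hi⟩ := funext fun t => by simp [ins, hi]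
    rw [this]; exact measurable_const
  · have : (fun t : ℝ => ins e z t i) = fun t => t := funext fun t => by simp [ins, hi]
    rw [this]; exact measurable_id

/-! ### Fubini: integrating the coordinate `e` first -/

/-- **Fubini along one coordinate**: for a measurable integrable `F` on `ℝ^ι`,
`∫ F = ∫ dz ∫ dt F(z|_{x_e = t})`, the outer integral over the other coordinates. [folklore] -/
theorem integral_eq_integral_integral_ins (e : ι) (F : (ι → ℝ) → ℂ) (hFm : Measurable F)
    (hF : Integrable F) :
    ∫ x, F x = ∫ z : {i // i ≠ e} → ℝ, ∫ t : ℝ, F (ins e z t) := by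
  set Φ := MeasurableEquiv.piEquivPiSubtypeProd (fun _ : ι => ℝ) (fun i => i ≠ e) with hΦdef
  have hΦ : MeasurePreserving Φ (Measure.pi fun _ : ι => (volume : Measure ℝ))
      ((Measure.pi fun _ : {i // i ≠ e} => (volume : Measure ℝ)).prod
        (Measure.pi fun _ : {i // ¬ i ≠ e} => (volume : Measure ℝ))) :=
    measurePreserving_piEquivPiSubtypeProd (fun _ : ι => (volume : Measure ℝ)) (fun i => i ≠ e)
  have hsymm := hΦ.symm Φ
  -- transport to the product and apply Fubini with the first factor outside
  have hF' : Integrable F (Measure.pi fun _ : ι => (volume : Measure ℝ)) := hF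
  have hint : Integrable (fun q => F (Φ.symm q))
      ((Measure.pi fun _ : {i // i ≠ e} => (volume : Measure ℝ)).prod
        (Measure.pi fun _ : {i // ¬ i ≠ e} => (volume : Measure ℝ))) :=
    (hsymm.integrable_comp_emb Φ.symm.measurableEmbedding).2 hF'
  have h1 : ∫ x, F x = ∫ q, F (Φ.symm q) ∂((Measure.pi fun _ : {i // i ≠ e} => (volume : Measure ℝ)).prod
        (Measure.pi fun _ : {i // ¬ i ≠ e} => (volume : Measure ℝ))) :=
    (hsymm.integral_comp' F).symm
  rw [h1, integral_prod _ hint]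
  refine integral_congr_ae (Filter.Eventually.of_forall fun z => ?_)
  -- the inner integral over the one-point index type `{i // ¬ i ≠ e}` is an integral over `ℝ`
  set i₀ : {i // ¬ i ≠ e} := ⟨e, fun h => h rfl⟩ with hi₀
  have hrew : ∀ y : {i // ¬ i ≠ e} → ℝ, Φ.symm (z, y) = ins e z (y i₀) := by
    intro y
    funext i
    change (if h : i ≠ e then z ⟨i, h⟩ else y ⟨i, h⟩) = ins e z (y i₀) i
    by_cases hi : i ≠ e
    · simp [ins, hi]
    · rw [dif_neg hi]
      simp only [ins, hi, dite_false]
      congr 1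
      exact Subtype.ext (of_not_not hi)
  change ∫ y, F (Φ.symm (z, y)) ∂(Measure.pi fun _ : {i // ¬ i ≠ e} => (volume : Measure ℝ)) = _
  simp_rw [hrew]
  have hg : Measurable fun t : ℝ => F (ins e z t) := hFm.comp (measurable_ins e z)
  rw [← integral_map (μ := Measure.pi fun _ : {i // ¬ i ≠ e} => (volume : Measure ℝ))
      (φ := fun y : {i // ¬ i ≠ e} → ℝ => y i₀) (f := fun t : ℝ => F (ins e z t))
      (measurable_pi_apply i₀).aemeasurable hg.aestronglyMeasurable]
  rw [show (fun y : {i // ¬ i ≠ e} → ℝ => y i₀) = Function.eval i₀ from rfl, Measure.pi_map_eval]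
  have hempty : (Finset.univ : Finset {i // ¬ i ≠ e}).erase i₀ = ∅ :=
    Finset.eq_empty_of_forall_notMem fun j hj =>
      (Finset.ne_of_mem_erase hj) (Subtype.ext ((of_not_not j.2).trans (of_not_not i₀.2).symm))
  rw [hempty, Finset.prod_empty, one_smul]

/-! ### The one-dimensional computation -/

/-- The one-dimensional Gaussian–Fourier computation behind Lemma 3: for `a > 0` and real
`L, Q, ρ`, `∫ e^{-(a t² + 2tL + Q)/2} e^{iρt} g dt = e^{-ρ²/(2a)} ∫ e^{-(a t² + 2tL + Q)/2} e^{iρ(-L/a)} g dt`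
(both sides equal `g √(2π/a) e^{-Q/2 + (iρ - L)²/(2a)}`). [cite: FrohlichSpencerCMP1982, (2.66)] -/
theorem integral_gaussian_cexp_linear_oneDim {a : ℝ} (ha : 0 < a) (L Q ρ : ℝ) (g : ℂ) :
    ∫ t : ℝ, (Real.exp (-(a * t ^ 2 + 2 * t * L + Q) / 2) : ℂ) * (cexp (I * ρ * t) * g) =
      cexp (-(ρ ^ 2 / (2 * a))) *
        ∫ t : ℝ, (Real.exp (-(a * t ^ 2 + 2 * t * L + Q) / 2) : ℂ) * (cexp (I * ρ * ((-L / a : ℝ) : ℂ)) * g) := by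
  have hb : (-(a / 2 : ℂ)).re < 0 := by
    rw [neg_re, neg_lt_zero]; norm_cast; positivity
  -- left side in the normal form `g ∫ cexp (b t² + c t + d)`
  have hL : ∀ t : ℝ, (Real.exp (-(a * t ^ 2 + 2 * t * L + Q) / 2) : ℂ) * (cexp (I * ρ * t) * g) =
      g * cexp (-(a / 2 : ℂ) * t ^ 2 + (-(L : ℂ) + I * ρ) * t + (-(Q / 2) : ℂ)) := by
    intro t
    rw [Complex.ofReal_exp, mul_comm (cexp (I * ρ * t)) g, ← mul_assoc, mul_comm _ g, mul_assoc,
      ← Complex.exp_add]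
    congr 2
    push_cast
    ring
  have hR : ∀ t : ℝ, (Real.exp (-(a * t ^ 2 + 2 * t * L + Q) / 2) : ℂ) * (cexp (I * ρ * ((-L / a : ℝ) : ℂ)) * g) =
      (cexp (I * ρ * ((-L / a : ℝ) : ℂ)) * g) * cexp (-(a / 2 : ℂ) * t ^ 2 + (-(L : ℂ)) * t + (-(Q / 2) : ℂ)) := by
    intro t
    rw [Complex.ofReal_exp, mul_comm]
    congr 2
    push_cast
    ring
  simp_rw [hL, hR]
  rw [integral_const_mul, integral_const_mul, integral_cexp_quadratic hb, integral_cexp_quadratic hb]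
  -- compare the closed forms
  have ha0 : (a : ℂ) ≠ 0 := by exact_mod_cast ha.ne'
  have key : cexp (-(Q / 2 : ℂ) - (-(L : ℂ) + I * ρ) ^ 2 / (4 * -(a / 2 : ℂ))) =
      cexp (-(ρ ^ 2 / (2 * a))) * cexp (I * ρ * ((-L / a : ℝ) : ℂ)) *
        cexp (-(Q / 2 : ℂ) - (-(L : ℂ)) ^ 2 / (4 * -(a / 2 : ℂ))) := by
    rw [← Complex.exp_add, ← Complex.exp_add]
    congr 1
    push_cast
    field_simp
    ring_nf
    rw [Complex.I_sq]
    ring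
  rw [key]
  ring

/-! ### Lemma 3 -/

omit [DecidableEq ι] in
/-- Measurability of the quadratic form. [folklore] -/
theorem measurable_quadForm (A : ι → ι → ℝ) : Measurable (quadForm A) := by
  unfold quadForm
  refine Finset.measurable_sum _ fun i _ => Finset.measurable_sum _ fun j _ => ?_
  exact ((measurable_pi_apply i).const_mul _).mul (measurable_pi_apply j)

/-- Measurability of the off-diagonal form. [folklore] -/
theorem measurable_offDiag (A : ι → ι → ℝ) (e : ι) : Measurable (offDiag A e) := by
  unfold offDiag
  exact Finset.measurable_sum _ fun j _ => (measurable_pi_apply j).const_mul _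

/-- Measurability of the conditional mean. [folklore] -/
theorem measurable_condMean (A : ι → ι → ℝ) (e : ι) : Measurable (condMean A e) := by
  unfold condMean
  exact ((measurable_offDiag A e).neg).div_const _

/-- **Fröhlich–Spencer 1982, Lemma 3 (integrating out one coordinate of a Gaussian).** Let
`w_A(x) = exp(-½ Q_A(x))` be an integrable centred Gaussian weight on `ℝ^ι` (`A` symmetric,
`A_{ee} > 0`), `e` a coordinate, `G` bounded measurable and independent of `x_e`, `ρ ∈ ℝ`. Then
`∫ w_A(x) e^{iρ x_e} G(x) dx = e^{-ρ²/(2A_{ee})} ∫ w_A(x) e^{iρ ᾱ_e(x)} G(x) dx` with the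
conditional mean `ᾱ_e = condMean A e` (independent of `x_e`). In FS82, `A = β⁻¹(δd + ε)` on the
links of `Λ*`, `A_{ee} = (n_e + ε)/β` with `n_e ≤ 6` the number of plaquettes containing the link,
whence the renormalising factor `e^{-(β/2n_e)ρ²} ≤ e^{-(β/12)ρ²}` of (2.63)–(2.64).
[cite: FrohlichSpencerCMP1982, §2.8 Lemma 3, (2.63)–(2.67), pp. 428–429] -/
theorem integral_gaussian_coord_cexp (A : ι → ι → ℝ) (hA : ∀ i j, A i j = A j i) (e : ι)
    (he : 0 < A e e) (hint : Integrable fun x : ι → ℝ => Real.exp (-(quadForm A x) / 2))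
    (G : (ι → ℝ) → ℂ) (hGm : Measurable G) (C : ℝ) (hGb : ∀ x, ‖G x‖ ≤ C)
    (hGe : ∀ x t, G (update x e t) = G x) (ρ : ℝ) :
    ∫ x, (Real.exp (-(quadForm A x) / 2) : ℂ) * (cexp (I * ρ * x e) * G x) =
      cexp (-(ρ ^ 2 / (2 * A e e))) *
        ∫ x, (Real.exp (-(quadForm A x) / 2) : ℂ) * (cexp (I * ρ * condMean A e x) * G x) := by
  -- integrability of both integrands: bounded by `C w_A`
  have hw : Measurable fun x : ι → ℝ => Real.exp (-(quadForm A x) / 2) :=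
    Real.measurable_exp.comp ((measurable_quadForm A).neg.div_const 2)
  have hbound : ∀ (φ : (ι → ℝ) → ℝ), Measurable φ →
      Integrable fun x => (Real.exp (-(quadForm A x) / 2) : ℂ) * (cexp (I * ρ * φ x) * G x) := by
    intro φ hφ
    refine Integrable.mono' (hint.norm.mul_const C) ?_ (Filter.Eventually.of_forall fun x => ?_)
    · exact ((Complex.measurable_ofReal.comp hw).mul
        ((Complex.measurable_exp.comp ((Complex.measurable_ofReal.comp hφ).const_mul _)).mul
          hGm)).aestronglyMeasurable
    · rw [norm_mul, norm_mul, Complex.norm_real, Real.norm_eq_abs]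
      have h1 : ‖cexp (I * ρ * φ x)‖ = 1 := by
        rw [show I * ρ * φ x = ((ρ * φ x : ℝ) : ℂ) * I by push_cast; ring, Complex.norm_exp_ofReal_mul_I]
      rw [h1, one_mul]
      exact mul_le_mul_of_nonneg_left (hGb x) (abs_nonneg _)
  have hmeas : ∀ (φ : (ι → ℝ) → ℝ), Measurable φ →
      Measurable fun x => (Real.exp (-(quadForm A x) / 2) : ℂ) * (cexp (I * ρ * φ x) * G x) :=
    fun φ hφ => (Complex.measurable_ofReal.comp hw).mul
      ((Complex.measurable_exp.comp ((Complex.measurable_ofReal.comp hφ).const_mul _)).mul hGm)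
  have hI1 := hbound (fun x => x e) (measurable_pi_apply e)
  have hI2 := hbound (condMean A e) (measurable_condMean A e)
  rw [integral_eq_integral_integral_ins e _ (hmeas _ (measurable_pi_apply e)) hI1,
    integral_eq_integral_integral_ins e _ (hmeas _ (measurable_condMean A e)) hI2,
    ← integral_const_mul]
  refine integral_congr_ae (Filter.Eventually.of_forall fun z => ?_)
  -- for fixed values `z` of the other coordinates: the one-dimensional computation
  set x₀ := ins e z 0 with hx₀
  have hq : ∀ t, quadForm A (ins e z t) = A e e * t ^ 2 + 2 * t * offDiag A e x₀ + quadForm A x₀ := by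
    intro t
    rw [ins_eq_update e z t 0, quadForm_update A hA, ← hx₀]
    congr 1
    rw [show update x₀ e 0 = x₀ by rw [hx₀, ← ins_eq_update]]
  have hG : ∀ t, G (ins e z t) = G x₀ := fun t => by rw [ins_eq_update e z t 0, hGe]
  have hm : ∀ t, condMean A e (ins e z t) = -offDiag A e x₀ / A e e := fun t => by
    rw [ins_eq_update e z t 0, condMean_update, ← hx₀, condMean]
  simp only [ins_self, hq, hG, hm]
  exact integral_gaussian_cexp_linear_oneDim he _ _ ρ (G x₀)

/-! ### Linear phases and their renormalisation (iterating Lemma 3: FS82 (2.68), Corollary 4) -/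

/-- The linear phase `⟨c, x⟩ = ∑ⱼ cⱼ xⱼ`. [folklore] -/
def lin (c : ι → ℝ) (x : ι → ℝ) : ℝ := ∑ j, c j * x j

omit [DecidableEq ι] in
/-- Measurability of the linear phase. [folklore] -/
theorem measurable_lin (c : ι → ℝ) : Measurable (lin c) := by
  unfold lin
  exact Finset.measurable_sum _ fun j _ => (measurable_pi_apply j).const_mul _

/-- Splitting off the coordinate `e` of a linear phase. [folklore] -/
theorem lin_eq_add (c : ι → ℝ) (e : ι) (x : ι → ℝ) :
    lin c x = c e * x e + ∑ j ∈ univ.erase e, c j * x j := by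
  rw [lin, ← Finset.add_sum_erase _ _ (Finset.mem_univ e)]

/-- **Renormalising the coefficient vector at the coordinate `b`** (FS82 (2.68): `α(ρ̄)` replaces
`ρ_b α_b` by `ρ_b ᾱ_b`): the new coefficients are `0` at `b` and `c_j - c_b A_{bj}/A_{bb}`
elsewhere. [cite: FrohlichSpencerCMP1982, (2.68) p. 429] -/
def renorm (A : ι → ι → ℝ) (b : ι) (c : ι → ℝ) : ι → ℝ :=
  fun j => if j = b then 0 else c j - c b * A b j / A b b

/-- `c_b ᾱ_b(x) + ∑_{j ≠ b} c_j x_j = ⟨renorm A b c, x⟩`. [cite: FrohlichSpencerCMP1982, (2.68)] -/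
theorem mul_condMean_add_sum_eq_lin_renorm (A : ι → ι → ℝ) (b : ι) (c : ι → ℝ) (x : ι → ℝ) :
    c b * condMean A b x + ∑ j ∈ univ.erase b, c j * x j = lin (renorm A b c) x := by
  rw [lin_eq_add _ b]
  simp only [renorm, if_true, zero_mul, zero_add, condMean, offDiag]
  rw [mul_div_assoc', ← neg_mul_eq_mul_neg, neg_mul_eq_neg_mul, Finset.mul_sum, Finset.sum_div,
    ← Finset.sum_add_distrib] -- c_b * (-Σ)/A = Σ (-c_b A_bj x_j / A)
  refine Finset.sum_congr rfl fun j hj => ?_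
  rw [if_neg (Finset.ne_of_mem_erase hj)]
  ring

/-- **Lemma 3 for a linear phase**: integrating out the coordinate `b` replaces `⟨c, x⟩` by
`⟨renorm A b c, x⟩` at the cost of the factor `e^{-c_b²/(2A_{bb})}`.
[cite: FrohlichSpencerCMP1982, §2.8 Lemma 3 and (2.68)] -/
theorem integral_gaussian_lin_cexp (A : ι → ι → ℝ) (hA : ∀ i j, A i j = A j i) (b : ι)
    (hb : 0 < A b b) (hint : Integrable fun x : ι → ℝ => Real.exp (-(quadForm A x) / 2))
    (G : (ι → ℝ) → ℂ) (hGm : Measurable G) (C : ℝ) (hGb : ∀ x, ‖G x‖ ≤ C)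
    (hGb' : ∀ x t, G (update x b t) = G x) (c : ι → ℝ) :
    ∫ x, (Real.exp (-(quadForm A x) / 2) : ℂ) * (cexp (I * lin c x) * G x) =
      cexp (-((c b) ^ 2 / (2 * A b b))) *
        ∫ x, (Real.exp (-(quadForm A x) / 2) : ℂ) * (cexp (I * lin (renorm A b c) x) * G x) := by
  -- absorb the phase of the other coordinates into `G`
  set R : (ι → ℝ) → ℝ := fun x => ∑ j ∈ univ.erase b, c j * x j with hR
  have hRm : Measurable R := Finset.measurable_sum _ fun j _ => (measurable_pi_apply j).const_mul _
  have hRu : ∀ x t, R (update x b t) = R x := fun x t =>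
    Finset.sum_congr rfl fun j hj => by rw [update_of_ne (Finset.ne_of_mem_erase hj)]
  set G' : (ι → ℝ) → ℂ := fun x => cexp (I * R x) * G x with hG'
  have hG'm : Measurable G' :=
    (Complex.measurable_exp.comp ((Complex.measurable_ofReal.comp hRm).const_mul _)).mul hGm
  have hG'b : ∀ x, ‖G' x‖ ≤ C := fun x => by
    rw [hG', norm_mul, show I * R x = ((R x : ℝ) : ℂ) * I by ring, Complex.norm_exp_ofReal_mul_I,
      one_mul]
    exact hGb x
  have hG'u : ∀ x t, G' (update x b t) = G' x := fun x t => by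
    simp only [hG', hRu, hGb']
  have key := integral_gaussian_coord_cexp A hA b hb hint G' hG'm C hG'b hG'u (c b)
  -- rewrite both integrands
  have h1 : ∀ x, cexp (I * lin c x) * G x = cexp (I * (c b) * x b) * G' x := fun x => by
    rw [hG', ← mul_assoc, ← Complex.exp_add, lin_eq_add c b]
    congr 2
    rw [hR]
    push_cast
    ring
  have h2 : ∀ x, cexp (I * lin (renorm A b c) x) * G x = cexp (I * (c b) * condMean A b x) * G' x :=
    fun x => by
    rw [hG', ← mul_assoc, ← Complex.exp_add, ← mul_condMean_add_sum_eq_lin_renorm]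
    congr 2
    rw [hR]
    push_cast
    ring
  simp_rw [h1, h2]
  convert key using 2

/-- **Renormalising at a set `B` of mutually non-interacting coordinates** (`A_{bb'} = 0` for
`b ≠ b'` in `B`): coefficients `0` on `B` and `c_j - ∑_{b∈B} c_b A_{bj}/A_{bb}` off `B` (FS82
(2.68): the renormalised current density `ρ̄`). [cite: FrohlichSpencerCMP1982, (2.68) p. 429] -/
def renormSet (A : ι → ι → ℝ) (B : Finset ι) (c : ι → ℝ) : ι → ℝ :=
  fun j => if j ∈ B then 0 else c j - ∑ b ∈ B, c b * A b j / A b b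

omit [Fintype ι] in
/-- Renormalising at `∅` does nothing. [folklore] -/
@[simp] theorem renormSet_empty (A : ι → ι → ℝ) (c : ι → ℝ) : renormSet A ∅ c = c := by
  funext j; simp [renormSet]

omit [Fintype ι] in
/-- One coordinate at a time: `renormSet (insert b₀ B) c = renormSet B (renorm b₀ c)` when `b₀ ∉ B`
does not interact with `B`. [folklore] -/
theorem renormSet_insert (A : ι → ι → ℝ) (hA : ∀ i j, A i j = A j i) {B : Finset ι} {b₀ : ι}
    (hb₀ : b₀ ∉ B) (horth : ∀ b ∈ B, A b₀ b = 0) (c : ι → ℝ) :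
    renormSet A (insert b₀ B) c = renormSet A B (renorm A b₀ c) := by
  funext j
  by_cases hj0 : j = b₀
  · subst hj0
    have hl : renormSet A (insert j B) c j = 0 := by simp [renormSet]
    have hr : renormSet A B (renorm A j c) j = 0 := by
      simp only [renormSet, if_neg hb₀, renorm, if_true, zero_sub, neg_eq_zero]
      exact Finset.sum_eq_zero fun b hb => by rw [hA b j, horth b hb]; simp
    rw [hl, hr]
  · by_cases hjB : j ∈ B
    · simp [renormSet, hjB]
    · have hl : renormSet A (insert b₀ B) c j =
          c j - (c b₀ * A b₀ j / A b₀ b₀ + ∑ b ∈ B, c b * A b j / A b b) := by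
        simp [renormSet, hj0, hjB, Finset.sum_insert hb₀]
      have hr : renormSet A B (renorm A b₀ c) j =
          (c j - c b₀ * A b₀ j / A b₀ b₀) - ∑ b ∈ B, c b * A b j / A b b := by
        have hsum : ∑ b ∈ B, renorm A b₀ c b * A b j / A b b = ∑ b ∈ B, c b * A b j / A b b :=
          Finset.sum_congr rfl fun b hb => by
            simp only [renorm]
            rw [if_neg (show b ≠ b₀ from fun h => hb₀ (h ▸ hb)), horth b hb]
            ring
        simp only [renormSet, if_neg hjB, hsum]
        simp only [renorm, if_neg hj0]
      rw [hl, hr]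
      ring

/-- **Iterated Lemma 3 (the renormalisation of FS82 Corollary 4 for one linear phase).** For a
finite set `B` of coordinates with `A_{bb} > 0` and `A_{bb'} = 0` for `b ≠ b'` in `B` (no two of
them in a common plaquette), and `G` bounded measurable independent of the coordinates in `B`,
`∫ w_A e^{i⟨c,x⟩} G = exp(-∑_{b∈B} c_b²/(2A_{bb})) ∫ w_A e^{i⟨renormSet A B c, x⟩} G`.
[cite: FrohlichSpencerCMP1982, §2.8 Lemma 3, (2.68)–(2.69), Corollary 4 (proof, p. 430)] -/
theorem integral_gaussian_lin_cexp_renormSet (A : ι → ι → ℝ) (hA : ∀ i j, A i j = A j i)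
    (hint : Integrable fun x : ι → ℝ => Real.exp (-(quadForm A x) / 2))
    (G : (ι → ℝ) → ℂ) (hGm : Measurable G) (C : ℝ) (hGb : ∀ x, ‖G x‖ ≤ C) :
    ∀ (B : Finset ι), (∀ b ∈ B, 0 < A b b) → (∀ b ∈ B, ∀ b' ∈ B, b ≠ b' → A b b' = 0) →
      (∀ b ∈ B, ∀ x t, G (update x b t) = G x) → ∀ c : ι → ℝ,
        ∫ x, (Real.exp (-(quadForm A x) / 2) : ℂ) * (cexp (I * lin c x) * G x) =
          cexp (-(∑ b ∈ B, (c b) ^ 2 / (2 * A b b) : ℝ)) *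
            ∫ x, (Real.exp (-(quadForm A x) / 2) : ℂ) * (cexp (I * lin (renormSet A B c) x) * G x) := by
  intro B
  induction B using Finset.induction_on with
  | empty =>
    intro _ _ _ c
    simp
  | insert b₀ B hb₀ ih =>
    intro hpos horth hG c
    have hb₀pos : 0 < A b₀ b₀ := hpos b₀ (Finset.mem_insert_self _ _)
    have horth₀ : ∀ b ∈ B, A b₀ b = 0 := fun b hb =>
      horth b₀ (Finset.mem_insert_self _ _) b (Finset.mem_insert_of_mem hb) fun h => hb₀ (h ▸ hb)
    rw [integral_gaussian_lin_cexp A hA b₀ hb₀pos hint G hGm C hGb (hG b₀ (Finset.mem_insert_self _ _)) c,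
      ih (fun b hb => hpos b (Finset.mem_insert_of_mem hb))
        (fun b hb b' hb' hne => horth b (Finset.mem_insert_of_mem hb) b' (Finset.mem_insert_of_mem hb') hne)
        (fun b hb => hG b (Finset.mem_insert_of_mem hb)) (renorm A b₀ c),
      ← renormSet_insert A hA hb₀ horth₀, ← mul_assoc, ← Complex.exp_add, Finset.sum_insert hb₀]
    congr 2
    have hc : ∀ b ∈ B, renorm A b₀ c b = c b := fun b hb => by
      simp only [renorm]
      rw [if_neg (show b ≠ b₀ from fun h => hb₀ (h ▸ hb)), horth₀ b hb]; ring
    rw [Finset.sum_congr rfl fun b hb => by rw [hc b hb]]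
    push_cast
    ring

/-! ### Corollary 4: renormalising products of cosines -/

section Corollary4

variable {κ : Type*} [Fintype κ] [DecidableEq κ]

/-- The coefficients of the signed expansion `1 + K cos u = ∑_{n ∈ {0,1,-1}} a_K(n) e^{inu}`:
`a_K(0) = 1`, `a_K(±1) = K/2`. [folklore] -/
def cosCoef (K : ℝ) (n : ℤ) : ℂ := if n = 0 then 1 else (K / 2 : ℂ)

/-- The sign set `{0, 1, -1}`. [folklore] -/
def signs : Finset ℤ := {0, 1, -1}

omit [Fintype ι] [DecidableEq ι] in
/-- `1 + K cos u = ∑_{n ∈ {0, 1, -1}} a_K(n) e^{inu}`. [cite: FrohlichSpencerCMP1982, Corollary 4 (proof: cos(α - θ) = ½e^{i(α-θ)} + ½e^{-i(α-θ)}), p. 429] -/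
theorem one_add_mul_cos_eq_sum (K u : ℝ) :
    ((1 + K * Real.cos u : ℝ) : ℂ) = ∑ n ∈ signs, cosCoef K n * cexp (I * (n * u)) := by
  have h0 : (0 : ℤ) ∉ ({1, -1} : Finset ℤ) := by decide
  have h1 : (1 : ℤ) ∉ ({-1} : Finset ℤ) := by decide
  rw [signs, Finset.sum_insert h0, Finset.sum_insert h1, Finset.sum_singleton]
  simp only [cosCoef, if_true, one_ne_zero, if_false, Int.reduceNeg, neg_eq_zero, Int.cast_zero,
    zero_mul, mul_zero, Complex.exp_zero, mul_one, Int.cast_one, one_mul, Int.cast_neg, neg_mul]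
  push_cast
  rw [show (K : ℂ) * Complex.cos u = (K / 2 : ℂ) * (2 * Complex.cos u) by ring, Complex.two_cos,
    show (u : ℂ) * I = I * u by ring, show -(u : ℂ) * I = -(I * u) by ring]
  ring

/-- **The signed expansion of a product of cosine factors**:
`∏_k (1 + K_k cos u_k) = ∑_σ (∏_k a_{K_k}(σ_k)) e^{i ∑_k σ_k u_k}`, `σ` ranging over
`{0, 1, -1}^κ`. [cite: FrohlichSpencerCMP1982, Corollary 4 (proof), pp. 429–430] -/
theorem prod_one_add_mul_cos_eq_sum (K u : κ → ℝ) :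
    ((∏ k, (1 + K k * Real.cos (u k)) : ℝ) : ℂ) =
      ∑ σ ∈ Fintype.piFinset (fun _ : κ => signs),
        (∏ k, cosCoef (K k) (σ k)) * cexp (I * ∑ k, ((σ k : ℝ) * u k : ℝ)) := by
  rw [Complex.ofReal_prod]
  simp_rw [one_add_mul_cos_eq_sum, Finset.prod_univ_sum]
  refine Finset.sum_congr rfl fun σ _ => ?_
  rw [Finset.prod_mul_distrib, ← Complex.exp_sum, Complex.ofReal_sum, Finset.mul_sum]
  congr 2
  push_cast
  rfl

/-- `a_K(n) e^{-n² E} = a_{K e^{-E}}(n)` on `{0, 1, -1}`: the Gaussian factor renormalises the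
activity, `K ↦ z = K e^{-E}` (FS82 (2.69)). [cite: FrohlichSpencerCMP1982, (2.69) p. 429] -/
theorem cosCoef_mul_exp {n : ℤ} (hn : n ∈ signs) (K E : ℝ) :
    cosCoef K n * cexp (-((n : ℝ) ^ 2 * E : ℝ)) = cosCoef (K * Real.exp (-E)) n := by
  simp only [signs, Finset.mem_insert, Finset.mem_singleton] at hn
  rcases hn with rfl | rfl | rfl
  · simp [cosCoef]
  · simp only [cosCoef, one_ne_zero, if_false, Int.cast_one, one_pow, one_mul]
    push_cast
    ring
  · simp only [cosCoef, Int.reduceNeg, neg_eq_zero, one_ne_zero, if_false, Int.cast_neg, Int.cast_one,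
      neg_one_sq, one_mul]
    push_cast
    ring

omit [DecidableEq ι] [DecidableEq κ] in
/-- Linearity of the phase in the coefficient vector. [folklore] -/
theorem lin_sum_smul (σ : κ → ℝ) (ρ : κ → ι → ℝ) (x : ι → ℝ) :
    lin (fun j => ∑ k, σ k * ρ k j) x = ∑ k, σ k * lin (ρ k) x := by
  simp only [lin, Finset.mul_sum, Finset.sum_mul]
  rw [Finset.sum_comm]
  exact Finset.sum_congr rfl fun k _ => Finset.sum_congr rfl fun j _ => by ring

/-- Norm of a coefficient of the expansion. [folklore] -/
theorem norm_cosCoef_le (K : ℝ) (n : ℤ) : ‖cosCoef K n‖ ≤ 1 + |K| := by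
  unfold cosCoef
  split_ifs
  · simp
  · rw [show (K / 2 : ℂ) = ((K / 2 : ℝ) : ℂ) by push_cast; ring, Complex.norm_real, Real.norm_eq_abs,
      abs_div, abs_two]
    linarith [abs_nonneg K]

omit [DecidableEq ι] in
/-- **Expansion under the Gaussian integral**: `∫ w ∏_k (1 + K_k cos(φ_k - θ_k)) G =
∑_σ (∏ a)(e^{-i∑σθ}) ∫ w e^{i ∑_k σ_k φ_k} G` for bounded measurable `G` and measurable
phases `φ_k`. [cite: FrohlichSpencerCMP1982, Corollary 4 (proof), pp. 429–430] -/
theorem integral_prod_cos_expand (A : ι → ι → ℝ)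
    (hint : Integrable fun x : ι → ℝ => Real.exp (-(quadForm A x) / 2))
    (G : (ι → ℝ) → ℂ) (hGm : Measurable G) (C : ℝ) (hGb : ∀ x, ‖G x‖ ≤ C)
    (K θ : κ → ℝ) (φ : κ → (ι → ℝ) → ℝ) (hφ : ∀ k, Measurable (φ k)) :
    ∫ x, (Real.exp (-(quadForm A x) / 2) : ℂ) *
        ((((∏ k, (1 + K k * Real.cos (φ k x - θ k))) : ℝ) : ℂ) * G x) =
      ∑ σ ∈ Fintype.piFinset (fun _ : κ => signs),
        (∏ k, cosCoef (K k) (σ k)) * cexp (-(I * ∑ k, ((σ k : ℝ) * θ k : ℝ))) *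
          ∫ x, (Real.exp (-(quadForm A x) / 2) : ℂ) *
            (cexp (I * (∑ k, ((σ k : ℝ) * φ k x) : ℝ)) * G x) := by
  have hw : Measurable fun x : ι → ℝ => Real.exp (-(quadForm A x) / 2) :=
    Real.measurable_exp.comp ((measurable_quadForm A).neg.div_const 2)
  -- expand pointwise
  have hpt : ∀ x, (Real.exp (-(quadForm A x) / 2) : ℂ) *
      ((((∏ k, (1 + K k * Real.cos (φ k x - θ k))) : ℝ) : ℂ) * G x) =
      ∑ σ ∈ Fintype.piFinset (fun _ : κ => signs),
        (∏ k, cosCoef (K k) (σ k)) * cexp (-(I * ∑ k, ((σ k : ℝ) * θ k : ℝ))) *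
          ((Real.exp (-(quadForm A x) / 2) : ℂ) * (cexp (I * (∑ k, ((σ k : ℝ) * φ k x) : ℝ)) * G x)) := by
    intro x
    rw [prod_one_add_mul_cos_eq_sum, Finset.sum_mul, Finset.mul_sum]
    refine Finset.sum_congr rfl fun σ _ => ?_
    have : cexp (I * ∑ k, ((σ k : ℝ) * (φ k x - θ k) : ℝ)) =
        cexp (-(I * ∑ k, ((σ k : ℝ) * θ k : ℝ))) * cexp (I * (∑ k, ((σ k : ℝ) * φ k x) : ℝ)) := by
      rw [← Complex.exp_add]
      congr 1
      push_cast
      simp only [mul_sub, Finset.sum_sub_distrib]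
      ring
    rw [this]
    ring
  simp_rw [hpt]
  rw [integral_finsetSum]
  · refine Finset.sum_congr rfl fun σ _ => ?_
    rw [integral_const_mul]
  · intro σ _
    refine Integrable.const_mul ?_ _
    refine Integrable.mono' (hint.norm.mul_const C) ?_ (Filter.Eventually.of_forall fun x => ?_)
    · have hs : Measurable fun x => (∑ k, ((σ k : ℝ) * φ k x) : ℝ) :=
        Finset.measurable_sum _ fun k _ => (hφ k).const_mul _
      exact ((Complex.measurable_ofReal.comp hw).mul
        ((Complex.measurable_exp.comp ((Complex.measurable_ofReal.comp hs).const_mul _)).mul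
          hGm)).aestronglyMeasurable
    · rw [norm_mul, norm_mul, Complex.norm_real, Real.norm_eq_abs,
        show I * ((∑ k, (σ k : ℝ) * φ k x : ℝ) : ℂ) = ((∑ k, (σ k : ℝ) * φ k x : ℝ) : ℂ) * I by ring,
        Complex.norm_exp_ofReal_mul_I, one_mul]
      exact mul_le_mul_of_nonneg_left (hGb x) (abs_nonneg _)

omit [Fintype ι] [DecidableEq ι] [DecidableEq κ] in
/-- The combined coefficient vector `c_σ = ∑_k σ_k ρ_k` of a term of the expansion, restricted to
the integrated coordinates `B_k`, only sees its own density. [folklore] -/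
theorem sum_smul_apply_of_mem {ρ : κ → ι → ℝ} {Bk : κ → Finset ι}
    (hsupp : ∀ k k', k ≠ k' → ∀ b ∈ Bk k', ρ k b = 0) (σ : κ → ℝ) {k : κ} {b : ι} (hb : b ∈ Bk k) :
    ∑ k', σ k' * ρ k' b = σ k * ρ k b := by
  rw [Finset.sum_eq_single k]
  · intro k' _ hk'
    rw [hsupp k' k hk' b hb, mul_zero]
  · intro h; exact absurd (Finset.mem_univ k) h

omit [Fintype ι] in
/-- **The renormalised densities add up**: for disjoint, mutually non-interacting sets `B_k`
carrying only their own density, renormalising the combined vector `∑_k σ_k ρ_k` at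
`⋃_k B_k` gives `∑_k σ_k ρ̄_k` with `ρ̄_k = renormSet A (B_k) ρ_k`. [cite: FrohlichSpencerCMP1982, (2.68), Corollary 4] -/
theorem renormSet_biUnion_sum (A : ι → ι → ℝ) {ρ : κ → ι → ℝ} {Bk : κ → Finset ι}
    (hdisj : ∀ k k', k ≠ k' → Disjoint (Bk k) (Bk k'))
    (horth : ∀ k k', ∀ b ∈ Bk k, ∀ b' ∈ Bk k', b ≠ b' → A b b' = 0)
    (hsupp : ∀ k k', k ≠ k' → ∀ b ∈ Bk k', ρ k b = 0) (σ : κ → ℝ) :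
    renormSet A (Finset.univ.biUnion Bk) (fun j => ∑ k, σ k * ρ k j) =
      fun j => ∑ k, σ k * renormSet A (Bk k) (ρ k) j := by
  funext j
  by_cases hj : j ∈ Finset.univ.biUnion Bk
  · -- an integrated coordinate: both sides vanish
    rw [renormSet, if_pos hj]
    obtain ⟨k₀, -, hk₀⟩ := Finset.mem_biUnion.1 hj
    symm
    refine Finset.sum_eq_zero fun k _ => ?_
    rw [renormSet]
    by_cases hk : k = k₀
    · subst hk; rw [if_pos hk₀, mul_zero]
    · have hjk : j ∉ Bk k := fun h => Finset.disjoint_left.1 (hdisj k k₀ hk) h hk₀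
      rw [if_neg hjk, hsupp k k₀ hk j hk₀, zero_sub, mul_neg, neg_eq_zero]
      rw [Finset.sum_eq_zero fun b hb => ?_, mul_zero]
      rw [horth k k₀ b hb j hk₀ (fun h => hjk (h ▸ hb)), mul_zero, zero_div]
  · rw [renormSet, if_neg hj, Finset.sum_biUnion (fun k _ k' _ hkk' => hdisj k k' hkk')]
    have hrhs : ∀ k, σ k * renormSet A (Bk k) (ρ k) j =
        σ k * ρ k j - ∑ b ∈ Bk k, (σ k * ρ k b) * A b j / A b b := by
      intro k
      have hjk : j ∉ Bk k := fun h => hj (Finset.mem_biUnion.2 ⟨k, Finset.mem_univ k, h⟩)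
      rw [renormSet, if_neg hjk, mul_sub, Finset.mul_sum]
      congr 1
      exact Finset.sum_congr rfl fun b _ => by ring
    simp_rw [hrhs, Finset.sum_sub_distrib]
    congr 1
    refine Finset.sum_congr rfl fun k _ => Finset.sum_congr rfl fun b hb => ?_
    rw [sum_smul_apply_of_mem hsupp σ hb]

/-- **Fröhlich–Spencer 1982, Corollary 4 (renormalisation of activities and densities).** Let
`w_A` be an integrable centred Gaussian weight, `(ρ_k, K_k, θ_k)_k` a finite family of coefficient
vectors (current densities), activities and phases, and `B_k` finite sets of coordinates with
`A_{bb} > 0`, pairwise disjoint, mutually non-interacting (`A_{bb'} = 0` for `b ≠ b'` in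
`⋃ B_k`: "two different links do not belong to a common plaquette", guaranteed inside `B_ρ` by its
choice and across densities by the 1-ensemble property) and each carrying only its own density
(`ρ_k = 0` on `B_{k'}`, `k' ≠ k`); let `G` be bounded measurable and independent of these
coordinates. Then
`∫ w_A ∏_k [1 + K_k cos(⟨ρ_k, x⟩ - θ_k)] G = ∫ w_A ∏_k [1 + z_k cos(⟨ρ̄_k, x⟩ - θ_k)] G`
with the renormalised activities `z_k = K_k exp(-∑_{b∈B_k} ρ_k(b)²/(2A_{bb}))` ((2.69)) and
densities `ρ̄_k = renormSet A B_k ρ_k` ((2.68)). [cite: FrohlichSpencerCMP1982, §2.8 Corollary 4, (2.68)–(2.71), pp. 429–430] -/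
theorem integral_gaussian_prod_cos_renorm (A : ι → ι → ℝ) (hA : ∀ i j, A i j = A j i)
    (hint : Integrable fun x : ι → ℝ => Real.exp (-(quadForm A x) / 2))
    (G : (ι → ℝ) → ℂ) (hGm : Measurable G) (C : ℝ) (hGb : ∀ x, ‖G x‖ ≤ C)
    (ρ : κ → ι → ℝ) (K θ : κ → ℝ) (Bk : κ → Finset ι)
    (hpos : ∀ k, ∀ b ∈ Bk k, 0 < A b b)
    (hdisj : ∀ k k', k ≠ k' → Disjoint (Bk k) (Bk k'))
    (horth : ∀ k k', ∀ b ∈ Bk k, ∀ b' ∈ Bk k', b ≠ b' → A b b' = 0)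
    (hsupp : ∀ k k', k ≠ k' → ∀ b ∈ Bk k', ρ k b = 0)
    (hG : ∀ k, ∀ b ∈ Bk k, ∀ x t, G (update x b t) = G x) :
    ∫ x, (Real.exp (-(quadForm A x) / 2) : ℂ) *
        ((((∏ k, (1 + K k * Real.cos (lin (ρ k) x - θ k))) : ℝ) : ℂ) * G x) =
      ∫ x, (Real.exp (-(quadForm A x) / 2) : ℂ) *
        ((((∏ k, (1 + (K k * Real.exp (-(∑ b ∈ Bk k, (ρ k b) ^ 2 / (2 * A b b)))) *
            Real.cos (lin (renormSet A (Bk k) (ρ k)) x - θ k))) : ℝ) : ℂ) * G x) := by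
  set Ball := Finset.univ.biUnion Bk with hBall
  rw [integral_prod_cos_expand A hint G hGm C hGb K θ (fun k => lin (ρ k)) fun k => measurable_lin _,
    integral_prod_cos_expand A hint G hGm C hGb _ θ (fun k => lin (renormSet A (Bk k) (ρ k)))
      fun k => measurable_lin _]
  refine Finset.sum_congr rfl fun σ hσ => ?_
  have hσ' : ∀ k, σ k ∈ signs := fun k => Fintype.mem_piFinset.1 hσ k
  -- the phases are linear: `∑_k σ_k ⟨ρ_k, x⟩ = ⟨c_σ, x⟩`
  have hlin : ∀ (ρ' : κ → ι → ℝ) (x : ι → ℝ), (∑ k, ((σ k : ℝ) * lin (ρ' k) x) : ℝ) =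
      lin (fun j => ∑ k, (σ k : ℝ) * ρ' k j) x := fun ρ' x => (lin_sum_smul _ ρ' x).symm
  simp_rw [hlin]
  -- renormalise the combined phase at `Ball`
  have hBpos : ∀ b ∈ Ball, 0 < A b b := fun b hb => by
    obtain ⟨k, -, hk⟩ := Finset.mem_biUnion.1 hb
    exact hpos k b hk
  have hBorth : ∀ b ∈ Ball, ∀ b' ∈ Ball, b ≠ b' → A b b' = 0 := fun b hb b' hb' hne => by
    obtain ⟨k, -, hk⟩ := Finset.mem_biUnion.1 hb
    obtain ⟨k', -, hk'⟩ := Finset.mem_biUnion.1 hb'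
    exact horth k k' b hk b' hk' hne
  have hBG : ∀ b ∈ Ball, ∀ x t, G (update x b t) = G x := fun b hb => by
    obtain ⟨k, -, hk⟩ := Finset.mem_biUnion.1 hb
    exact hG k b hk
  rw [integral_gaussian_lin_cexp_renormSet A hA hint G hGm C hGb Ball hBpos hBorth hBG,
    renormSet_biUnion_sum A hdisj horth hsupp]
  -- the Gaussian factor renormalises the activities
  have hE : (∑ b ∈ Ball, (∑ k, (σ k : ℝ) * ρ k b) ^ 2 / (2 * A b b) : ℝ) =
      ∑ k, (σ k : ℝ) ^ 2 * ∑ b ∈ Bk k, (ρ k b) ^ 2 / (2 * A b b) := by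
    rw [hBall, Finset.sum_biUnion (fun k _ k' _ hkk' => hdisj k k' hkk')]
    refine Finset.sum_congr rfl fun k _ => ?_
    rw [Finset.mul_sum]
    refine Finset.sum_congr rfl fun b hb => ?_
    rw [sum_smul_apply_of_mem hsupp _ hb]
    ring
  rw [hE]
  have hF : cexp (-((∑ k, (σ k : ℝ) ^ 2 * ∑ b ∈ Bk k, ρ k b ^ 2 / (2 * A b b) : ℝ) : ℂ)) =
      ∏ k, cexp (-(((σ k : ℝ) ^ 2 * ∑ b ∈ Bk k, ρ k b ^ 2 / (2 * A b b) : ℝ) : ℂ)) := by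
    rw [← Complex.exp_sum]
    congr 1
    push_cast
    rw [← Finset.sum_neg_distrib]
  have hP : (∏ k, cosCoef (K k) (σ k)) *
      cexp (-((∑ k, (σ k : ℝ) ^ 2 * ∑ b ∈ Bk k, ρ k b ^ 2 / (2 * A b b) : ℝ) : ℂ)) =
      ∏ k, cosCoef (K k * Real.exp (-(∑ b ∈ Bk k, ρ k b ^ 2 / (2 * A b b)))) (σ k) := by
    rw [hF, ← Finset.prod_mul_distrib]
    exact Finset.prod_congr rfl fun k _ => cosCoef_mul_exp (hσ' k) _ _
  rw [← hP]
  ring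

end Corollary4

end GaussianCoord

end Literature.Probability.LatticeModels
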